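import Summits.ResolutionOfSingularities.ResolutionOfSingularities.Theorems.StallVertexCompanion7
import HarnessLib

/-!
# StallVertexCompanion8 — decomp-res node «StallVertexCompanion (lens-5 g29, rev 10 of the node «StallVertex»;
critic row 192 CLEARED +1)», tree file 8/8 of the node

Content from the decomp-res lens-5 g29 node file `HOME/decomp-res-lens-5/g29/StallVertexCompanion.lean` (pin
deaa8fea) with the critic's ten mechanical lint fixes (fixed sha256 245dae5b; HOME =
run/shared/lean/pub/decomp-res); critic CRITIC-LEDGER row 192 CLEARED +1 — provenance, the fix list, critic text and
the lens header in full in part 2 of the node, `StallVertexCompanion`.  Namespace `…Theorems.StallVertex`;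
`--supports stmt-ResolutionOfSingularities-31770`.

## This file

Continuation 8/8 of `StallVertexCompanion` (same namespace and sections of the node, cut at the tree's 400-line cap;
section variables / opens replayed): `section WalkTangent`, `section Classes`, `section ClassesTangent` — carries
`tangent_law`, `NoDeficientPositiveSkewStalledTailsDeep`, `noDeficientPositiveSkewStalledTailsDeep_holds`,
`NoFlatPositiveSkewStalledTailsDeep`, `positive_iff_flatPositive`, `positive_iff_deficient_flatPositive`,
`skew_iff_flatPositive_nullFlat`, `defectWalksDeep_iff_flatPositive_nullFlat`, `closes_flatPositive_nullFlat`,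
`NoSecantPositiveSkewStalledTailsDeep`, `noSecantPositiveSkewStalledTailsDeep_holds`,
`NoTangentPositiveSkewStalledTailsDeep`, `positive_iff_tangentPositive`, `positive_iff_secant_tangent`,
`defectWalksDeep_iff_tangentPositive_nullFlat`, `closes_tangentPositive_nullFlat`.

[WRITER NOTE (decomp-res writer g12): file split only (tree files ≤ 400 lines) plus the ten critic-ordered lint
fixes listed in `StallVertexCompanion`; namespace, sections, section variables / opens / `set_option maxHeartbeats …
in` lines and every declaration otherwise exactly as in the lens.]

(Sources: KawanoueMatsuki2012 arXiv:1205.4556 Prop. 3 (the companion (c_{f,𝕆}·𝕄^{-a}, μ̃·a)); Moh1987; Hauser2010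
(kangaroo points); HauserPerlega2019 §2; HauserPerlega2024; CossartPiltant2008 §2; CossartJannsenSaito2020 Ch. 8;
Benito–Villamayor (monomial case); Hironaka2005.)
-/

noncomputable section

open MvPolynomial Finset
open Literature.AlgebraicGeometry.Resolution
open Literature.AlgebraicGeometry.Resolution.Hauser2010
open Literature.AlgebraicGeometry.Resolution.HauserPerlega2024
open Literature.Barriers.ResolutionOfSingularities
open Literature.AlgebraicGeometry.Resolution.PointBlowup
open Summit.ResolutionOfSingularities.ResolutionOfSingularities.Theses
open Summit.ResolutionOfSingularities.ResolutionOfSingularities.Theorems.TightDefectClasses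
open Summit.ResolutionOfSingularities.ResolutionOfSingularities.Theorems.ProximityCut
open Summit.ResolutionOfSingularities.ResolutionOfSingularities.Theorems.ExitLaw
open Summit.ResolutionOfSingularities.ResolutionOfSingularities.Theorems.DifferentialShade

namespace Summit.ResolutionOfSingularities.ResolutionOfSingularities.Theorems.StallVertex

section WalkTangent

variable {K : Type} [Field K] [DecidableEq K]

/-- **THE TANGENT LAW** (generation 29, kernel).  On a positive skew stalled tail that STAYS ON THE NEWEST divisor
again and again, EVERY `μ_P`-minimiser is TANGENT at EVERY `t ≥ N`: the initial form of its carried derivative is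
`r · u^{B(t)} · ℓ_t^{w}`, `w = d₀ − |B(t)| = a₀ μ̃ ≥ 1`, with `ℓ_t` a linear form through the direction of move `t` —
Kawanoue–Matsuki's companion `c_t = g_{J₀}/𝕄^{a₀}` has a PURE-POWER tangent cone along the whole tail.  Proof:
backwards from the next `StaysOnNewest` time (`tangentAt_of_staysOnNewest`) along the persisting minimiser
(`minimiser_succ`), one move at a time (`tangentAt_of_tangentAt_succ`).  A hypothesis-free law of the deep process
quoted by no `StallVertex*` class. [new] [folklore] -/
theorem tangent_law {p e : ℕ} (hp : p.Prime) [CharP K p] {s₀ : State (Fin 3) K}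
    (hs : IsRoot (p ^ e) s₀) (W : ForcedWalk (p ^ e) s₀) (N : ℕ)
    (hstall : ∀ t, N ≤ t → (ifp W (t + 1)).muTilde (p ^ e) = (ifp W t).muTilde (p ^ e))
    (hskew : ∀ (k : Fin 3) (N' : ℕ), ∃ t, N' ≤ t ∧ (W.j t = k ∨ W.b t k ≠ 0))
    (hSio : ∀ M : ℕ, ∃ t, M ≤ t ∧ StaysOnNewest W t)
    (hpos : (0 : WithTop ℚ) < (ifp W N).muTilde (p ^ e)) :
    ∀ t, N ≤ t → ∀ J₀ ∈ (ifp W t).idx,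
      (ifp W t).muP (p ^ e) = levelRatio (ordZero ((ifp W t).gen J₀)) (p ^ e - J₀.degree) → TangentAt W t J₀ := by
  have key : ∀ k t, N ≤ t → StaysOnNewest W (t + k) → ∀ J₀ ∈ (ifp W t).idx,
      (ifp W t).muP (p ^ e) = levelRatio (ordZero ((ifp W t).gen J₀)) (p ^ e - J₀.degree) → TangentAt W t J₀ := by
    intro k
    induction k with
    | zero =>
      intro t ht hT J₀ hJ₀ hμ
      exact tangentAt_of_staysOnNewest hp hs W N hstall hskew hpos ht hT hJ₀ hμ
    | succ k ih =>
      intro t ht hT J₀ hJ₀ hμ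
      obtain ⟨hJ₀', hμ'⟩ := minimiser_succ hp hs W t (hstall t ht) hJ₀ hμ
      exact tangentAt_of_tangentAt_succ hp hs W N hstall hskew hpos ht hJ₀ hμ
        (ih (t + 1) (by omega) (by rw [show t + 1 + k = t + (k + 1) by omega]; exact hT) J₀ hJ₀' hμ')
  intro t ht J₀ hJ₀ hμ
  obtain ⟨T, hTt, hT⟩ := hSio t
  exact key (T - t) t ht (by rw [Nat.add_sub_cancel' hTt]; exact hT) J₀ hJ₀ hμ

end WalkTangent

section Classes

/-! ### §4m (rev 10, generation 29) THE DEFICIENT POSITIVE CELL IS EMPTY; THE RESIDUAL IS THE FLAT POSITIVE TAILS -/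

/-- SUB-CELL of the positive skew leaf: **DEFICIENT POSITIVE TAILS** — the binders of
`NoPositiveSkewStalledTailsDeep` VERBATIM + «at some `t ≥ N` some young letter of some `μ_P`-minimiser is DEFICIENT»
(its divisor mass is NOT attained by the minimiser: `μ_{P,D_i} ≠ ord_{u_i} g_{J₀} / a₀`, i.e. Kawanoue–Matsuki's
boundary monomial `𝕄^{a₀}` does not divide `g_{J₀}` exactly).  EMPTY by the flat law. [new] -/
def NoDeficientPositiveSkewStalledTailsDeep : Prop :=
  ∀ p : ℕ, p.Prime → ∀ e : ℕ, 2 ≤ e → ∀ (K : Type) [Field K] [CharP K p] [PerfectField K] [DecidableEq K]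
    (s₀ : State (Fin 3) K), IsRoot (p ^ e) s₀ → ∀ W : ForcedWalk (p ^ e) s₀, (∀ i, 1 ≤ (W.st i).shade) →
    ∀ N : ℕ, (∀ t, N ≤ t → (W.st (t + 1)).shade = (W.st t).shade) →
    (∀ t, N ≤ t → ordZero (W.st t).F ≠ ((p ^ e : ℕ) : ℕ∞)) →
    (∀ M : ℕ, ∃ t, M ≤ t ∧ StaysOnNewest W t) → (∀ M : ℕ, ∃ t, M ≤ t ∧ W.b t ≠ 0) →
    (∀ (k : Fin 3) (N' : ℕ), ∃ t, N' ≤ t ∧ (W.j t = k ∨ W.b t k ≠ 0)) →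
    (∀ t, N ≤ t → (ifp W (t + 1)).muTilde (p ^ e) = (ifp W t).muTilde (p ^ e)) →
    (∀ t, N ≤ t → VertexLawEqAt W t) → (∀ t, N ≤ t → OriginLawAt W t) →
    (∀ (s : ℕ) (c : Fin 3 → K), ¬ ContactLineFrom W s c) →
    (0 : WithTop ℚ) < (ifp W N).muTilde (p ^ e) →
    (∃ t, N ≤ t ∧ ∃ J₀ ∈ (ifp W t).idx,
      (ifp W t).muP (p ^ e) = levelRatio (ordZero ((ifp W t).gen J₀)) (p ^ e - J₀.degree) ∧
      ∃ i ∈ (ifp W t).young, ¬ NondefAt W t J₀ i) → False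

/-- **THE DEFICIENT POSITIVE CELL IS EMPTY** (kernel, every `q = p^e`, every field of characteristic `p`): the flat
law. [new] [folklore] -/
theorem noDeficientPositiveSkewStalledTailsDeep_holds : NoDeficientPositiveSkewStalledTailsDeep := by
  intro p hp e _ K _ _ _ _ s₀ hs W _ N _ _ _ _ hskew hstall _ _ _ _ hdef
  obtain ⟨t, ht, J₀, hJ₀, hμ, i, hi, hnd⟩ := hdef
  exact hnd (flat_law hp hs W N hstall hskew t ht J₀ hJ₀ hμ i hi)

/-- LOCATED RESIDUAL (rev 10, EXACT): **THE FLAT POSITIVE TAILS** — the positive leaf's binders VERBATIM + THE FLAT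
LAW as a binder: at every `t ≥ N` every young letter of every minimiser is non-deficient, i.e. the young monomial of
every carried minimiser IS Kawanoue–Matsuki's boundary monomial `𝕄^{a₀}` and the companion `c_t = g_{J₀}/𝕄^{a₀}` is a
polynomial of order EXACTLY `a₀ μ̃ ∈ ℕ_{>0}` (`companion_level`).  The binder is DERIVABLE (`flat_law`); it is put on
record so that the next seat works the companion `c_t` itself (tangent–drift law, g29 PAPER.md).  EXPECTED-EMPTY. -/
def NoFlatPositiveSkewStalledTailsDeep : Prop :=
  ∀ p : ℕ, p.Prime → ∀ e : ℕ, 2 ≤ e → ∀ (K : Type) [Field K] [CharP K p] [PerfectField K] [DecidableEq K]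
    (s₀ : State (Fin 3) K), IsRoot (p ^ e) s₀ → ∀ W : ForcedWalk (p ^ e) s₀, (∀ i, 1 ≤ (W.st i).shade) →
    ∀ N : ℕ, (∀ t, N ≤ t → (W.st (t + 1)).shade = (W.st t).shade) →
    (∀ t, N ≤ t → ordZero (W.st t).F ≠ ((p ^ e : ℕ) : ℕ∞)) →
    (∀ M : ℕ, ∃ t, M ≤ t ∧ StaysOnNewest W t) → (∀ M : ℕ, ∃ t, M ≤ t ∧ W.b t ≠ 0) →
    (∀ (k : Fin 3) (N' : ℕ), ∃ t, N' ≤ t ∧ (W.j t = k ∨ W.b t k ≠ 0)) →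
    (∀ t, N ≤ t → (ifp W (t + 1)).muTilde (p ^ e) = (ifp W t).muTilde (p ^ e)) →
    (∀ t, N ≤ t → VertexLawEqAt W t) → (∀ t, N ≤ t → OriginLawAt W t) →
    (∀ (s : ℕ) (c : Fin 3 → K), ¬ ContactLineFrom W s c) →
    (0 : WithTop ℚ) < (ifp W N).muTilde (p ^ e) →
    (∀ t, N ≤ t → ∀ J₀ ∈ (ifp W t).idx,
      (ifp W t).muP (p ^ e) = levelRatio (ordZero ((ifp W t).gen J₀)) (p ^ e - J₀.degree) →
      ∀ i ∈ (ifp W t).young, NondefAt W t J₀ i) → False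

/-- **EXACT RE-LOCATION**: positive leaf `↔` flat positive tails (the flat binder is discharged by `flat_law`).
[new] [folklore] -/
theorem positive_iff_flatPositive : NoPositiveSkewStalledTailsDeep ↔ NoFlatPositiveSkewStalledTailsDeep := by
  constructor
  · intro h p hp e he K _ _ _ _ s₀ hs W hsh N hplat hexc hS hT hskew hstall hrig horig hlf hpos _
    exact h p hp e he K s₀ hs W hsh N hplat hexc hS hT hskew hstall hrig horig hlf hpos
  · intro h p hp e he K _ _ _ _ s₀ hs W hsh N hplat hexc hS hT hskew hstall hrig horig hlf hpos
    exact h p hp e he K s₀ hs W hsh N hplat hexc hS hT hskew hstall hrig horig hlf hpos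
      (flat_law hp hs W N hstall hskew)

/-- **EXACT SPLIT** of the positive leaf: (deficient sub-cell, EMPTY) `∧` (flat positive residual). [new] [folklore] -/
theorem positive_iff_deficient_flatPositive : NoPositiveSkewStalledTailsDeep ↔
    NoDeficientPositiveSkewStalledTailsDeep ∧ NoFlatPositiveSkewStalledTailsDeep := by
  rw [positive_iff_flatPositive]
  exact ⟨fun h => ⟨noDeficientPositiveSkewStalledTailsDeep_holds, h⟩, fun h => h.2⟩

/-- The skew residual on the rev-10 leaves: `NoSkewJointTailsDeep ↔ (FLAT POSITIVE) ∧ (NULL-FLAT)`. [new] [folklore] -/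
theorem skew_iff_flatPositive_nullFlat : CoefficientCut.NoSkewJointTailsDeep ↔
    NoFlatPositiveSkewStalledTailsDeep ∧ NoNullFlatSkewStalledTailsDeep := by
  rw [skew_iff_positive_nullFlat, positive_iff_flatPositive]

/-- **NODE EQUATION (rev 10) to the target BY NAME**: `MaxContactCut.DefectWalksDeep ↔ (FLAT POSITIVE) ∧ (NULL-FLAT)`
— the planar column and the deep arc law are tree theorems (`GhostDescent.defectWalksDeep_iff_skewLeaves`). [new] [folklore] -/
theorem defectWalksDeep_iff_flatPositive_nullFlat : MaxContactCut.DefectWalksDeep ↔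
    NoFlatPositiveSkewStalledTailsDeep ∧ NoNullFlatSkewStalledTailsDeep := by
  rw [GhostDescent.defectWalksDeep_iff_skewLeaves, positive_iff_flatPositive]

/-- **`closes` (rev 10)**: the two current leaves `⟹ MaxContactCut.DefectWalksDeep`, the host item 31770 BY NAME.
[new] [folklore] -/
theorem closes_flatPositive_nullFlat (hI : NoFlatPositiveSkewStalledTailsDeep)
    (hZ : NoNullFlatSkewStalledTailsDeep) : MaxContactCut.DefectWalksDeep :=
  defectWalksDeep_iff_flatPositive_nullFlat.mpr ⟨hI, hZ⟩

end Classes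

section ClassesTangent

/-! ### §3c (rev 10, generation 29) THE TANGENT CUT OF THE POSITIVE LEAF: secant tails EMPTY -/

/-- SUB-CELL: **SECANT POSITIVE TAILS** — positive-leaf binders VERBATIM + «some `t ≥ N`, some minimiser is NOT tangent».
EMPTY by `tangent_law`. -/
def NoSecantPositiveSkewStalledTailsDeep : Prop :=
  ∀ p : ℕ, p.Prime → ∀ e : ℕ, 2 ≤ e → ∀ (K : Type) [Field K] [CharP K p] [PerfectField K] [DecidableEq K]
    (s₀ : State (Fin 3) K), IsRoot (p ^ e) s₀ → ∀ W : ForcedWalk (p ^ e) s₀, (∀ i, 1 ≤ (W.st i).shade) →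
    ∀ N : ℕ, (∀ t, N ≤ t → (W.st (t + 1)).shade = (W.st t).shade) →
    (∀ t, N ≤ t → ordZero (W.st t).F ≠ ((p ^ e : ℕ) : ℕ∞)) →
    (∀ M : ℕ, ∃ t, M ≤ t ∧ StaysOnNewest W t) → (∀ M : ℕ, ∃ t, M ≤ t ∧ W.b t ≠ 0) →
    (∀ (k : Fin 3) (N' : ℕ), ∃ t, N' ≤ t ∧ (W.j t = k ∨ W.b t k ≠ 0)) →
    (∀ t, N ≤ t → (ifp W (t + 1)).muTilde (p ^ e) = (ifp W t).muTilde (p ^ e)) →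
    (∀ t, N ≤ t → VertexLawEqAt W t) → (∀ t, N ≤ t → OriginLawAt W t) →
    (∀ (s : ℕ) (c : Fin 3 → K), ¬ ContactLineFrom W s c) →
    (0 : WithTop ℚ) < (ifp W N).muTilde (p ^ e) →
    (∃ t, N ≤ t ∧ ∃ J₀ ∈ (ifp W t).idx,
      (ifp W t).muP (p ^ e) = levelRatio (ordZero ((ifp W t).gen J₀)) (p ^ e - J₀.degree) ∧
      ¬ TangentAt W t J₀) → False

/-- EMPTY by the tangent law. [folklore] -/
theorem noSecantPositiveSkewStalledTailsDeep_holds : NoSecantPositiveSkewStalledTailsDeep := by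
  intro p hp e _ K _ _ _ _ s₀ hs W _ N _ _ hSio _ hskew hstall _ _ _ hpos hsec
  obtain ⟨t, ht, J₀, hJ₀, hμ, hnt⟩ := hsec
  exact hnt (tangent_law hp hs W N hstall hskew hSio hpos t ht J₀ hJ₀ hμ)

/-- LOCATED RESIDUAL (generation 29): **TANGENT POSITIVE TAILS** — positive-leaf binders VERBATIM + the tangent law as a binder
(the companion's cone is `ℓ_t^{a₀μ̃}` at every `t ≥ N`; by the DRIFT LAW `ℓ_{t+1} ≐ carry(ℓ_t) + γ_t u_{j_t}`,
`γ_t ≠ 0` exactly at the interferences).  EXPECTED-EMPTY. -/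
def NoTangentPositiveSkewStalledTailsDeep : Prop :=
  ∀ p : ℕ, p.Prime → ∀ e : ℕ, 2 ≤ e → ∀ (K : Type) [Field K] [CharP K p] [PerfectField K] [DecidableEq K]
    (s₀ : State (Fin 3) K), IsRoot (p ^ e) s₀ → ∀ W : ForcedWalk (p ^ e) s₀, (∀ i, 1 ≤ (W.st i).shade) →
    ∀ N : ℕ, (∀ t, N ≤ t → (W.st (t + 1)).shade = (W.st t).shade) →
    (∀ t, N ≤ t → ordZero (W.st t).F ≠ ((p ^ e : ℕ) : ℕ∞)) →
    (∀ M : ℕ, ∃ t, M ≤ t ∧ StaysOnNewest W t) → (∀ M : ℕ, ∃ t, M ≤ t ∧ W.b t ≠ 0) →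
    (∀ (k : Fin 3) (N' : ℕ), ∃ t, N' ≤ t ∧ (W.j t = k ∨ W.b t k ≠ 0)) →
    (∀ t, N ≤ t → (ifp W (t + 1)).muTilde (p ^ e) = (ifp W t).muTilde (p ^ e)) →
    (∀ t, N ≤ t → VertexLawEqAt W t) → (∀ t, N ≤ t → OriginLawAt W t) →
    (∀ (s : ℕ) (c : Fin 3 → K), ¬ ContactLineFrom W s c) →
    (0 : WithTop ℚ) < (ifp W N).muTilde (p ^ e) →
    (∀ t, N ≤ t → ∀ J₀ ∈ (ifp W t).idx,
      (ifp W t).muP (p ^ e) = levelRatio (ordZero ((ifp W t).gen J₀)) (p ^ e - J₀.degree) → TangentAt W t J₀) →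
    False

/-- EXACT re-location of the positive leaf on the tangent tails. [folklore] -/
theorem positive_iff_tangentPositive : NoPositiveSkewStalledTailsDeep ↔ NoTangentPositiveSkewStalledTailsDeep := by
  constructor
  · intro h p hp e he K _ _ _ _ s₀ hs W hsh N hplat hexc hS hT hskew hstall hrig horig hlf hpos _
    exact h p hp e he K s₀ hs W hsh N hplat hexc hS hT hskew hstall hrig horig hlf hpos
  · intro h p hp e he K _ _ _ _ s₀ hs W hsh N hplat hexc hS hT hskew hstall hrig horig hlf hpos
    exact h p hp e he K s₀ hs W hsh N hplat hexc hS hT hskew hstall hrig horig hlf hpos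
      (tangent_law hp hs W N hstall hskew hS hpos)

/-- EXACT CUT of the positive leaf: secant ∧ tangent (the secant cell is closed in kernel). [folklore] -/
theorem positive_iff_secant_tangent :
    NoPositiveSkewStalledTailsDeep ↔ NoSecantPositiveSkewStalledTailsDeep ∧ NoTangentPositiveSkewStalledTailsDeep :=
  ⟨fun h => ⟨noSecantPositiveSkewStalledTailsDeep_holds, positive_iff_tangentPositive.mp h⟩,
    fun h => positive_iff_tangentPositive.mpr h.2⟩

/-- The host item re-located EXACTLY: `DefectWalksDeep ↔ tangent-positive ∧ null-flat`. [folklore] -/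
theorem defectWalksDeep_iff_tangentPositive_nullFlat :
    MaxContactCut.DefectWalksDeep ↔ NoTangentPositiveSkewStalledTailsDeep ∧ NoNullFlatSkewStalledTailsDeep := by
  rw [GhostDescent.defectWalksDeep_iff_skewLeaves, positive_iff_tangentPositive]

/-- The deciding theorem of generation 29 on the host item BY NAME: `MaxContactCut.DefectWalksDeep` from the TANGENT
positive residual and the null-flat leaf. [folklore] -/
theorem closes_tangentPositive_nullFlat (hI : NoTangentPositiveSkewStalledTailsDeep)
    (hZ : NoNullFlatSkewStalledTailsDeep) : MaxContactCut.DefectWalksDeep :=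
  GhostDescent.closes_leaves (positive_iff_tangentPositive.mpr hI) hZ

end ClassesTangent

end Summit.ResolutionOfSingularities.ResolutionOfSingularities.Theorems.StallVertex
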